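import Mathlib
import HarnessLib
import Summits.HubbardSuperconductivity.HubbardSuperconductivity.Theorems.KLProgrammeKLRegimeScaleZeroTwoLegTail3

/-!
# Route `KLProgramme`, ENGINE child (stmt-…-20437), stub (C) at `n = 0` (located #22, piece (a3)): the tail of the scale-`0` two-leg kernel from
# ANY order `n₀` (cumulant form), scaled weight, bare-frame closed form at `δ₀ = √46` (companion of `…ScaleZeroTwoLegTail3`)

Cell gate-hubbard-kl, seat p1 (g18).  `…ScaleZeroTwoLegTail3` is the `n₀ = 3` instance in the explicit Gaussian-convolution form
`T₃ = W₀ − e^{Δ}V + ½(e^{Δ}V² − (e^{Δ}V)²)`.  Rows `k = 3, 4` of stub (C) at `n = 0` (#22b, pen (R127)/(R129)) need an EXPLICIT third order and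
therefore the tail from order 4; the Literature truncation lemma exists at every order in CUMULANT form
(`GrassmannWeightedEffectiveActionTruncationDB.sum_wt_norm_kernel_effAction_add_sum_cumulant_le_of_gramBounded`:
`kernel_m W + Σ_{1≤n<n₀}(n!)⁻¹ kernel_m 𝓔ᵀ_C(−V;n)`, `𝓔ᵀ_C(−V;n) = cumulantOf (e^{Δ_C}((−V)^·)) n`).  This file threads the scaled-weight / bare-frame
bookkeeping of `…Tail3` through that generic lemma:
* `twoLeg_wsum_tailN_le` — any Gram-bounded covariance, any tree weight, pair weight `ω ≤ c·wt`: `≤ c·ρ⁻²·e‖V‖_{h,wt}·θ^{n₀−1}/(1−θ)`;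
* `twoLeg_offDiag_moment_pow_sum_tailN_le` — grid-point form, off-site `k`-th moment weight, `c = (2/λ)ᵏ`;
* **`twoLeg_offDiag_moment_pow_sum_tailN_frameZero_le`** — bare frame, `μ ∈ klWindowC`, `klEngL₃ β U ≤ L`, `δ₀ = √46`, `a` the normalised
  `(1+λ·diam)ᵏ`-weighted size of `SᵀC⁰_{>e₀}S`, `θ₀ = 16e⁹·46·a|U| ≤ 1/2`:
  `Σ_{p₁}[x⃗₁≠x⃗₀](1+|Δx̃|₁)ᵏ‖kernel₂(W₀ + Σ_{1≤n<n₀}(n!)⁻¹𝓔ᵀ(−V;n))‖ ≤ (2/λ)ᵏ·2·(16e⁹·46·|U|)·θ₀^{n₀−1}·β/(4M)` — order `|U|^{n₀}`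
  (`n₀ = 4`: `(2/λ)ᵏ·2¹⁷e³⁶46⁴a³U⁴β/4M`; under (C)'s door `U ≤ 10⁻³⁷` two spare powers of `U` book it at any honest `a`).
The weighted sizes `a` are hypotheses ([B1] / k3c5-p1 π3 / the Gevrey-tail route); no definition; everything PROVED.
References: BGM 2006 (2.13)–(2.14), (2.77)–(2.80), §3 [cite: BenfattoGiulianiMastropietro2006]; Pedra–Salmhofer 2008 Thm 2.4 [cite: PedraSalmhofer2008].
-/

noncomputable section

namespace Summit.HubbardSuperconductivity.HubbardSuperconductivity.Theorems.EngineV8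

set_option linter.dupNamespace false -- summit = problem name (single-conjunct summit), D-0017

open Real Finset Literature.MathematicalPhysics.QuantumLattice Literature.Probability.LatticeModels
open Literature.Probability.LatticeModels.BattleFederbush GrassmannAlgebra
open Summit.HubbardSuperconductivity.HubbardSuperconductivity.Theorems.KLRegimeSplit
open Summit.HubbardSuperconductivity.HubbardSuperconductivity.Theorems.DispersionFlow

variable {L N : ℕ} [NeZero L] [NeZero N]

/-! ## The tail from ANY order `n₀ ≥ 1` (cumulant form), scaled weight, bare-frame closed form -/

section TailN

omit [NeZero N] in
/-- **THE ORDER-≥`n₀` TAIL OF THE TWO-LEG KERNEL, weighted, one leg pinned** (BGM's truncated cumulant expansion at any `n₀ ≥ 1`, cumulant form):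
for a Gram-bounded covariance `C`, the bare grid vertex `V = V_N` with its `wt`-weighted pinned profile `Nw`, `wt`-pair-weighted row/column sums
`≤ α_w`, output weight `ρ`, `θ = eα_w‖V‖_{h,wt}/κ² < 1`, a pair weight `ω ≤ c·wt` (`c ≥ 0`), every pinned leg `w`:
`Σ_{Y : Y 0 = w} ω(Y)·‖kernel₂ W (Y) + Σ_{1 ≤ n < n₀} (n!)⁻¹ kernel₂ 𝓔ᵀ_C(−V; n) (Y)‖ ≤ c·(ρ⁻²·e‖V‖_{h,wt}·θ^{n₀−1}/(1−θ))`. -/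
theorem twoLeg_wsum_tailN_le (C : Matrix (GridLeg (GridPoint L N)) (GridLeg (GridPoint L N)) ℂ) (β U : ℝ)
    {wt : Finset (GridLeg (GridPoint L N)) → ℝ} (hwt : IsTreeWeight wt) {κ : ℝ} (hκ : 0 < κ) (hGB : IsGramBoundedR C κ)
    (Nw : ℕ → ℝ) (hNw0 : ∀ m', 0 ≤ Nw m')
    (hNw : ∀ m' (j : Fin (2 * m')) (w : GridLeg (GridPoint L N)),
      ∑ Y ∈ univ.filter (fun Y : Fin (2 * m') → GridLeg (GridPoint L N) => Y j = w),
        ‖kernel ℂ (hubbardGridInteraction L N β U) (2 * m') Y‖ * wt (univ.image Y) ≤ Nw m')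
    {αw : ℝ} (hαw : 0 < αw) (hrow : ∀ X, ∑ Y, ‖C X Y‖ * wt {X, Y} ≤ αw) (hcol : ∀ Y, ∑ X, ‖C X Y‖ * wt {X, Y} ≤ αw)
    {ρ : ℝ} (hρ : 0 < ρ) (hθ : Real.exp 1 * αw * normV (GridLeg (GridPoint L N)) κ ρ Nw / κ ^ 2 < 1)
    {n₀ : ℕ} (hn₀ : 0 < n₀)
    (ω : (Fin 2 → GridLeg (GridPoint L N)) → ℝ) {c : ℝ} (hc : 0 ≤ c) (hωle : ∀ Y, ω Y ≤ c * wt (univ.image Y))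
    (w : GridLeg (GridPoint L N)) :
    ∑ Y ∈ univ.filter (fun Y : Fin 2 → GridLeg (GridPoint L N) => Y 0 = w),
        ω Y * ‖kernel ℂ (effAction ℂ C (hubbardGridInteraction L N β U)) 2 Y + ∑ n ∈ Ico 1 n₀, ((n.factorial : ℂ))⁻¹ *
          kernel ℂ ((cumulantOf (fun k => evenGaussConv ℂ C
            ((⟨-hubbardGridInteraction L N β U, neg_mem (hubbardGridInteraction_mem_evenPart β U)⟩ :
              evenPart ℂ (GridLeg (GridPoint L N))) ^ k)) n : evenPart ℂ (GridLeg (GridPoint L N))) :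
                GrassmannAlgebra ℂ (GridLeg (GridPoint L N))) 2 Y‖ ≤
      c * (ρ⁻¹ ^ 2 * (Real.exp 1 * normV (GridLeg (GridPoint L N)) κ ρ Nw) *
        (Real.exp 1 * αw * normV (GridLeg (GridPoint L N)) κ ρ Nw / κ ^ 2) ^ (n₀ - 1) /
          (1 - Real.exp 1 * αw * normV (GridLeg (GridPoint L N)) κ ρ Nw / κ ^ 2)) := by
  obtain ⟨-, htr⟩ := sum_wt_norm_kernel_effAction_add_sum_cumulant_le_of_gramBounded C hwt hκ hGB (hubbardGridInteraction L N β U)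
    (hubbardGridInteraction_mem_evenPart β U) (constPart_hubbardGridInteraction β U) Nw hNw0 hNw hαw hrow hcol hρ hθ hn₀
  have h2 := htr (m := 2) two_pos 0 w
  calc ∑ Y ∈ univ.filter (fun Y : Fin 2 → GridLeg (GridPoint L N) => Y 0 = w), ω Y * ‖_‖
      ≤ ∑ Y ∈ univ.filter (fun Y : Fin 2 → GridLeg (GridPoint L N) => Y 0 = w), c * (wt (univ.image Y) * ‖kernel ℂ (effAction ℂ C (hubbardGridInteraction L N β U)) 2 Y + ∑ n ∈ Ico 1 n₀, ((n.factorial : ℂ))⁻¹ *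
          kernel ℂ ((cumulantOf (fun k => evenGaussConv ℂ C
            ((⟨-hubbardGridInteraction L N β U, neg_mem (hubbardGridInteraction_mem_evenPart β U)⟩ :
              evenPart ℂ (GridLeg (GridPoint L N))) ^ k)) n : evenPart ℂ (GridLeg (GridPoint L N))) :
                GrassmannAlgebra ℂ (GridLeg (GridPoint L N))) 2 Y‖) :=
        sum_le_sum fun Y _ => by
          rw [← mul_assoc]
          exact mul_le_mul_of_nonneg_right (hωle Y) (norm_nonneg _)
    _ = c * ∑ Y ∈ univ.filter (fun Y : Fin 2 → GridLeg (GridPoint L N) => Y 0 = w), wt (univ.image Y) * ‖kernel ℂ (effAction ℂ C (hubbardGridInteraction L N β U)) 2 Y + ∑ n ∈ Ico 1 n₀, ((n.factorial : ℂ))⁻¹ *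
          kernel ℂ ((cumulantOf (fun k => evenGaussConv ℂ C
            ((⟨-hubbardGridInteraction L N β U, neg_mem (hubbardGridInteraction_mem_evenPart β U)⟩ :
              evenPart ℂ (GridLeg (GridPoint L N))) ^ k)) n : evenPart ℂ (GridLeg (GridPoint L N))) :
                GrassmannAlgebra ℂ (GridLeg (GridPoint L N))) 2 Y‖ := by
        rw [mul_sum]
    _ ≤ _ := mul_le_mul_of_nonneg_left h2 hc

/-- **THE OFF-SITE `k`-TH SPATIAL MOMENT OF THE ORDER-≥`n₀` TAIL** (grid-point form, scaled weight `(1+λ·diam)ᵏ`, `0 < λ ≤ 1`, any Gram-bounded `C`):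
`Σ_{p₁}[x⃗₁ ≠ x⃗₀](1+|Δx̃₀|+|Δx̃₁|)ᵏ·‖kernel₂ W + Σ_{1≤n<n₀}(n!)⁻¹kernel₂ 𝓔ᵀ(−V;n)‖((p₀,σ,+),(p₁,σ,−)) ≤ (2/λ)ᵏ·ρ⁻²·e‖V‖_{h,wt}·θ^{n₀−1}/(1−θ)`. -/
theorem twoLeg_offDiag_moment_pow_sum_tailN_le (C : Matrix (GridLeg (GridPoint L N)) (GridLeg (GridPoint L N)) ℂ) (β U : ℝ)
    (k : ℕ) {β' : ℝ} (hβ' : 0 ≤ β') {lam : ℝ} (hlam0 : 0 < lam) (hlam1 : lam ≤ 1) {κ : ℝ} (hκ : 0 < κ) (hGB : IsGramBoundedR C κ)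
    (Nw : ℕ → ℝ) (hNw0 : ∀ m', 0 ≤ Nw m')
    (hNw : ∀ m' (j : Fin (2 * m')) (w : GridLeg (GridPoint L N)),
      ∑ Y ∈ univ.filter (fun Y : Fin (2 * m') → GridLeg (GridPoint L N) => Y j = w),
        ‖kernel ℂ (hubbardGridInteraction L N β U) (2 * m') Y‖ *
          diamWeight (fun s => (1 + lam * s) ^ k) (gridLabelDist L N β') ((univ.image Y).image gridLegPos) ≤ Nw m')
    {αw : ℝ} (hαw : 0 < αw)
    (hrow : ∀ X, ∑ Y, ‖C X Y‖ * diamWeight (fun s => (1 + lam * s) ^ k) (gridLabelDist L N β') {gridLegPos X, gridLegPos Y} ≤ αw)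
    (hcol : ∀ Y, ∑ X, ‖C X Y‖ * diamWeight (fun s => (1 + lam * s) ^ k) (gridLabelDist L N β') {gridLegPos X, gridLegPos Y} ≤ αw)
    {ρ : ℝ} (hρ : 0 < ρ) (hθ : Real.exp 1 * αw * normV (GridLeg (GridPoint L N)) κ ρ Nw / κ ^ 2 < 1) {n₀ : ℕ} (hn₀ : 0 < n₀)
    (σ : Fin 2) (p₀ : GridPoint L N) :
    ∑ p₁ : GridPoint L N, (if p₁.2 - p₀.2 = 0 then (0 : ℝ) else
        (1 + (((p₁.2 - p₀.2) 0).valMinAbs.natAbs : ℝ) + (((p₁.2 - p₀.2) 1).valMinAbs.natAbs : ℝ)) ^ k) *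
      ‖kernel ℂ (effAction ℂ C (hubbardGridInteraction L N β U)) 2 (fun i => ((![p₀, p₁] i, σ), i)) +
        ∑ n ∈ Ico 1 n₀, ((n.factorial : ℂ))⁻¹ *
          kernel ℂ ((cumulantOf (fun k => evenGaussConv ℂ C
            ((⟨-hubbardGridInteraction L N β U, neg_mem (hubbardGridInteraction_mem_evenPart β U)⟩ :
              evenPart ℂ (GridLeg (GridPoint L N))) ^ k)) n : evenPart ℂ (GridLeg (GridPoint L N))) :
                GrassmannAlgebra ℂ (GridLeg (GridPoint L N))) 2 (fun i => ((![p₀, p₁] i, σ), i))‖ ≤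
      (2 / lam) ^ k * (ρ⁻¹ ^ 2 * (Real.exp 1 * normV (GridLeg (GridPoint L N)) κ ρ Nw) *
        (Real.exp 1 * αw * normV (GridLeg (GridPoint L N)) κ ρ Nw / κ ^ 2) ^ (n₀ - 1) /
          (1 - Real.exp 1 * αw * normV (GridLeg (GridPoint L N)) κ ρ Nw / κ ^ 2)) := by
  set F : (Fin 2 → GridLeg (GridPoint L N)) → ℝ := fun Y =>
      ‖kernel ℂ (effAction ℂ C (hubbardGridInteraction L N β U)) 2 Y + ∑ n ∈ Ico 1 n₀, ((n.factorial : ℂ))⁻¹ *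
          kernel ℂ ((cumulantOf (fun k => evenGaussConv ℂ C
            ((⟨-hubbardGridInteraction L N β U, neg_mem (hubbardGridInteraction_mem_evenPart β U)⟩ :
              evenPart ℂ (GridLeg (GridPoint L N))) ^ k)) n : evenPart ℂ (GridLeg (GridPoint L N))) :
                GrassmannAlgebra ℂ (GridLeg (GridPoint L N))) 2 Y‖ with hF
  have hF0 : ∀ Y, 0 ≤ F Y := fun Y => norm_nonneg _
  set ω : (Fin 2 → GridLeg (GridPoint L N)) → ℝ := fun Y => if (Y 1).1.1.2 - (Y 0).1.1.2 = 0 then (0 : ℝ) else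
      (1 + ((((Y 1).1.1.2 - (Y 0).1.1.2) 0).valMinAbs.natAbs : ℝ) + ((((Y 1).1.1.2 - (Y 0).1.1.2) 1).valMinAbs.natAbs : ℝ)) ^ k with hω
  have hω0 : ∀ Y, 0 ≤ ω Y := fun Y => by rw [hω]; dsimp only; split_ifs <;> positivity
  have hpair : ∀ X Y : GridLeg (GridPoint L N), ({X, Y} : Finset (GridLeg (GridPoint L N))).image gridLegPos = {gridLegPos X, gridLegPos Y} :=
    fun X Y => by rw [image_insert, image_singleton]
  have h := twoLeg_wsum_tailN_le C β U (isTreeWeight_scaledPolyWt (L := L) (N := N) hβ' hlam0.le k) hκ hGB Nw hNw0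
    (fun m' j w => by simpa only [Finset.image_image] using hNw m' j w) hαw (fun X => by simpa only [hpair] using hrow X)
    (fun Y => by simpa only [hpair] using hcol Y) hρ hθ hn₀ ω (by positivity : (0 : ℝ) ≤ (2 / lam) ^ k)
    (fun Y => by simpa only [hω, Finset.image_image] using offDiagMomentWeight_pow_le_scaledPolyWt (L := L) (N := N) hβ' hlam0 hlam1 k Y)
    (((p₀, σ), 0))
  refine le_trans ?_ h
  refine le_trans (le_of_eq ?_) (sum_point_string_le_sum_pinned (fun Y => ω Y * F Y)
      (fun Y => mul_nonneg (hω0 Y) (hF0 Y)) σ p₀)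
  refine sum_congr rfl fun p₁ _ => ?_
  simp only [hω, hF, Matrix.cons_val_zero, Matrix.cons_val_one, Matrix.cons_val_fin_one]

variable {M : ℕ} [NeZero M]

/-- **THE OFF-SITE `k`-TH MOMENT OF THE ORDER-≥`n₀` TAIL AT THE BARE FRAME, CLOSED FORM** (every `k`, every `n₀ ≥ 1`, slope `0 < λ ≤ 1`): for
`μ ∈ klWindowC`, `0 < U`, `klBetaMin ≤ β`, `klEngL₃ β U ≤ L`, every `M ≥ 1`, with `a > 0` the normalised `(1+λ·diam)ᵏ`-weighted row/column size of the
bare scale-`0` grid covariance and `θ₀ := 16·e⁹·46·a·|U| ≤ 1/2`: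
`Σ_{p₁}[x⃗₁ ≠ x⃗₀](1+|Δx̃₀|+|Δx̃₁|)ᵏ·‖kernel₂ (W₀ + Σ_{1≤n<n₀}(n!)⁻¹𝓔ᵀ(−V;n)) ((p₀,σ,+),(p₁,σ,−))‖ ≤ (2/λ)ᵏ·2·(16e⁹·46·|U|)·θ₀^{n₀−1}·β/(4M)`
— order `|U|^{n₀}`; at `n₀ = 3` this is `…Tail3`'s `(2/λ)ᵏ2¹³e²⁷46³a²|U|³β/4M`, at `n₀ = 4` (rows 3–4 after an explicit third order) `(2/λ)ᵏ2¹⁷e³⁶46⁴a³U⁴β/4M`. -/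
theorem twoLeg_offDiag_moment_pow_sum_tailN_frameZero_le {μ : ℝ} (hμ : μ ∈ klWindowC) {U : ℝ} (hU : 0 < U) {β : ℝ}
    (hβ : klBetaMin ≤ β) (hL : klEngL₃ β U ≤ L) (k : ℕ) {lam : ℝ} (hlam0 : 0 < lam) (hlam1 : lam ≤ 1) {a : ℝ} (ha : 0 < a)
    (hrow : ∀ X, ∑ Y, ‖((hubbardGridSub L M β (2 * (2 * M))).transpose * hubbardCovAboveCT L M β μ 0 0 klE0 *
        hubbardGridSub L M β (2 * (2 * M))) X Y‖ *
        diamWeight (fun s => (1 + lam * s) ^ k) (gridLabelDist L (2 * (2 * M)) β) {gridLegPos X, gridLegPos Y} ≤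
          a * ((2 * (2 * M) : ℕ) : ℝ) / β)
    (hcol : ∀ Y, ∑ X, ‖((hubbardGridSub L M β (2 * (2 * M))).transpose * hubbardCovAboveCT L M β μ 0 0 klE0 *
        hubbardGridSub L M β (2 * (2 * M))) X Y‖ *
        diamWeight (fun s => (1 + lam * s) ^ k) (gridLabelDist L (2 * (2 * M)) β) {gridLegPos X, gridLegPos Y} ≤
          a * ((2 * (2 * M) : ℕ) : ℝ) / β)
    (hsmall : 16 * Real.exp 1 ^ 9 * 46 * a * |U| ≤ 1 / 2) {n₀ : ℕ} (hn₀ : 0 < n₀)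
    (σ : Fin 2) (p₀ : GridPoint L (2 * (2 * M))) :
    ∑ p₁ : GridPoint L (2 * (2 * M)), (if p₁.2 - p₀.2 = 0 then (0 : ℝ) else
        (1 + (((p₁.2 - p₀.2) 0).valMinAbs.natAbs : ℝ) + (((p₁.2 - p₀.2) 1).valMinAbs.natAbs : ℝ)) ^ k) *
      ‖kernel ℂ (effAction ℂ ((hubbardGridSub L M β (2 * (2 * M))).transpose * hubbardCovAboveCT L M β μ 0 0 klE0 *
              hubbardGridSub L M β (2 * (2 * M))) (hubbardGridInteraction L (2 * (2 * M)) β U)) 2 (fun i => ((![p₀, p₁] i, σ), i)) +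
        ∑ n ∈ Ico 1 n₀, ((n.factorial : ℂ))⁻¹ *
          kernel ℂ ((cumulantOf (fun k => evenGaussConv ℂ ((hubbardGridSub L M β (2 * (2 * M))).transpose *
              hubbardCovAboveCT L M β μ 0 0 klE0 * hubbardGridSub L M β (2 * (2 * M)))
            ((⟨-hubbardGridInteraction L (2 * (2 * M)) β U, neg_mem (hubbardGridInteraction_mem_evenPart β U)⟩ :
              evenPart ℂ (GridLeg (GridPoint L (2 * (2 * M))))) ^ k)) n : evenPart ℂ (GridLeg (GridPoint L (2 * (2 * M))))) :
                GrassmannAlgebra ℂ (GridLeg (GridPoint L (2 * (2 * M))))) 2 (fun i => ((![p₀, p₁] i, σ), i))‖ ≤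
      (2 / lam) ^ k * (2 * (16 * Real.exp 1 ^ 9 * 46 * |U|) * (16 * Real.exp 1 ^ 9 * 46 * a * |U|) ^ (n₀ - 1) *
        (β / ((2 * (2 * M) : ℕ) : ℝ))) := by
  haveI : NeZero (2 * (2 * M)) := ⟨by have := NeZero.ne M; omega⟩
  have hβ0 : 0 < β := lt_of_lt_of_le (by norm_num [klBetaMin]) hβ
  have hN : (0 : ℝ) < ((2 * (2 * M) : ℕ) : ℝ) := by have := NeZero.ne M; positivity
  have h46 : (2 * (7 + 16) : ℝ) = 46 := by norm_num
  have hκ : (0 : ℝ) < Real.sqrt (2 * (7 + 16)) := Real.sqrt_pos.2 (by norm_num)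
  have hκsq : Real.sqrt (2 * (7 + 16)) ^ 2 = 46 := by rw [Real.sq_sqrt (by norm_num), h46]
  have hGB := isGramBoundedR_scaleZero_free_klEngL₃ (L := L) (M := M) hμ hβ hL
  have hα : 0 < a * ((2 * (2 * M) : ℕ) : ℝ) / β := by positivity
  have hθeq' := theta_frameZero_eq_gen (L := L) (M := M) hβ0 hκ U a
  have hθeq : Real.exp 1 * (a * ((2 * (2 * M) : ℕ) : ℝ) / β) *
      normV (GridLeg (GridPoint L (2 * (2 * M)))) (Real.sqrt (2 * (7 + 16))) (Real.sqrt (2 * (7 + 16)))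
        (fun m' => if m' = 1 then |β| / ((2 * (2 * M) : ℕ) : ℝ) * (0 : TrigPolyC4v).coeffNorm 0
          else if m' = 2 then |U| * |β| / ((2 * (2 * M) : ℕ) : ℝ) else 0) / Real.sqrt (2 * (7 + 16)) ^ 2 =
      16 * Real.exp 1 ^ 9 * 46 * a * |U| := by rw [hθeq', hκsq]
  have hθ0 : 0 ≤ 16 * Real.exp 1 ^ 9 * 46 * a * |U| := by positivity
  have hθlt : Real.exp 1 * (a * ((2 * (2 * M) : ℕ) : ℝ) / β) *
      normV (GridLeg (GridPoint L (2 * (2 * M)))) (Real.sqrt (2 * (7 + 16))) (Real.sqrt (2 * (7 + 16)))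
        (fun m' => if m' = 1 then |β| / ((2 * (2 * M) : ℕ) : ℝ) * (0 : TrigPolyC4v).coeffNorm 0
          else if m' = 2 then |U| * |β| / ((2 * (2 * M) : ℕ) : ℝ) else 0) / Real.sqrt (2 * (7 + 16)) ^ 2 < 1 := by
    rw [hθeq]; exact hsmall.trans_lt (by norm_num)
  have hP0 : ∀ m', 0 ≤ (if m' = 1 then |β| / ((2 * (2 * M) : ℕ) : ℝ) * (0 : TrigPolyC4v).coeffNorm 0
      else if m' = 2 then |U| * |β| / ((2 * (2 * M) : ℕ) : ℝ) else 0 : ℝ) := fun m' => by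
    have := TrigPolyC4v.coeffNorm_nonneg 0 (0 : TrigPolyC4v); split_ifs <;> positivity
  have h := twoLeg_offDiag_moment_pow_sum_tailN_le _ β U k hβ0.le hlam0 hlam1 hκ hGB _ hP0
    (sum_norm_kernel_hubbardGridInteraction_mul_scaledPolyWt_le β U lam k) hα hrow hcol hκ hθlt hn₀ σ p₀
  refine h.trans ?_
  refine mul_le_mul_of_nonneg_left ?_ (by positivity)
  rw [hθeq]
  have hnV := normV_frameZero_eq (L := L) (M := M) (Real.sqrt (2 * (7 + 16))) (Real.sqrt (2 * (7 + 16))) β U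
  rw [hnV]
  have he2 : Real.exp 2 = Real.exp 1 ^ 2 := by rw [← Real.exp_nat_mul]; norm_num
  -- the prefactor identity: `√46⁻²·e·(e²(√46+√46))⁴·|U||β|/N = 16e⁹·46·|U|·β/N`
  have hs4 : Real.sqrt (2 * (7 + 16)) ^ 4 = (46 : ℝ) ^ 2 := by
    rw [show (4 : ℕ) = 2 * 2 from rfl, pow_mul, hκsq]
  have hX : (Real.sqrt (2 * (7 + 16)))⁻¹ ^ 2 *
      (Real.exp 1 * ((Real.exp 2 * (Real.sqrt (2 * (7 + 16)) + Real.sqrt (2 * (7 + 16)))) ^ 4 *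
        (|U| * |β| / ((2 * (2 * M) : ℕ) : ℝ)))) = 16 * Real.exp 1 ^ 9 * 46 * |U| * (β / ((2 * (2 * M) : ℕ) : ℝ)) := by
    have hsum : Real.sqrt (2 * (7 + 16)) + Real.sqrt (2 * (7 + 16)) = 2 * Real.sqrt (2 * (7 + 16)) := by ring
    rw [hsum, abs_of_pos hβ0, he2, inv_pow, hκsq]
    have : (Real.exp 1 ^ 2 * (2 * Real.sqrt (2 * (7 + 16)))) ^ 4 = Real.exp 1 ^ 8 * 16 * (46 : ℝ) ^ 2 := by
      rw [mul_pow, mul_pow, ← pow_mul, hs4]; ring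
    rw [this]
    field_simp
  set X := (Real.sqrt (2 * (7 + 16)))⁻¹ ^ 2 *
      (Real.exp 1 * ((Real.exp 2 * (Real.sqrt (2 * (7 + 16)) + Real.sqrt (2 * (7 + 16)))) ^ 4 *
        (|U| * |β| / ((2 * (2 * M) : ℕ) : ℝ)))) with hXdef
  set θ₀ := 16 * Real.exp 1 ^ 9 * 46 * a * |U| with hθ₀
  have hX0 : 0 ≤ X := by rw [hXdef]; positivity
  have hθle : θ₀ ≤ 1 / 2 := hsmall
  have hpow0 : 0 ≤ θ₀ ^ (n₀ - 1) := pow_nonneg hθ0 _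
  -- `X·θ₀^{n₀-1}/(1−θ₀) ≤ 2·X·θ₀^{n₀-1}`
  have hfrac : X * θ₀ ^ (n₀ - 1) / (1 - θ₀) ≤ 2 * X * θ₀ ^ (n₀ - 1) := by
    rw [div_le_iff₀ (by linarith)]
    nlinarith [mul_nonneg hX0 hpow0]
  refine hfrac.trans (le_of_eq ?_)
  rw [hX]; ring

end TailN

end Summit.HubbardSuperconductivity.HubbardSuperconductivity.Theorems.EngineV8

end
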